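/-
COR-CM (cell pub-hodgecm2) — Δ2 BRIDGE, ORIENTATION AUDIT T2∕T5, wall-breaker wb-9 gen 6 (prover-pub-hodgecm2-d2bridge-wb-9-g6-0).
THE «μ-KEY» HAZARD CERTIFICATE, generic layer: the μ ↦ μᶜ adapter at the TOWER dictionary (any key), and its (c)(d) supplied BY VALUE from a
HYPOTHETICAL component-Albanese record `J₁` at instance `ι₁` for the twisted App.-C datum — into the CONJUGATE key.  THEOREMS ONLY (kernel lane):
no `def`, no instance, no notation, no named-fact hypothesis, no `sorry`; nothing landed is edited or restated (adapt-1's and wb-4's theorems are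
the live-key ∕ `ῑ₁`-cofan instances of these, token for token).  FRAMING: HC_CM is NOT proved; «Δ2 BRIDGE CLOSED» is NOT claimed; `hLiuC` = a
READING r8; `J₁` is NOT claimed to exist (DECISION #13 (i)∕(iii): the tree's only component Albanese for this datum is at `ῑ₁`).
-/
import Summits.HodgeConjecture.CorCM.D2Bridge.AdapterMuConjAtPin
import Summits.HodgeConjecture.CorCM.D2Bridge.R3OfComponentAlbaneseIota1
import HarnessLib

set_option autoImplicit false

/-!
# The μ ↦ μᶜ adapter at the tower dictionary, and its (c)(d) from a component Albanese at instance `ι₁` (conjugate key)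

[Liu2021] Y. Liu, *Fourier–Jacobi cycles and arithmetic relative trace formula*, Camb. J. Math. **9** (2021) = arXiv:2102.11518.

PARITY RULE (pub-hodgecm2/INBOX l.≈14600, wb-9 g6): a [Thm. 4.18]-row with tail at `ν` and blocks `ω(λ, ·, ·)` yields a `(0,1)`-keyed combined
reading at a `PhiMu` index line `i` iff `λ = μ_i` (Ω-pin) and a component Albanese for the rows' §4.2 datum exists at an instance `σ ∉ Φ_ν`:
the pieces built from `J@σ` are keyed `d.IsReflexOfTypeG σ Φ_ν` (✔ `nonempty_hcmPieces_atJRecordPin`, `hadmμ`), records of Hodge type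
`(0,1)` iff `σ ∉ Φ_ν` (✔ `tau_notMem_cmType_of_isReflexOfType_bar`).  For the adapter's `hLiuC` (tail `ν`, blocks `ω(νᶜ)`) this needs
`ν = μ_iᶜ` and `σ = ι₁` — the twisted datum's component Albanese AT INSTANCE `ι₁`, which the tree does NOT hold.  This file supplies the
generic composition with that object as a HYPOTHESIS `J₁`:

* §1 `socket_conjAdm_of_componentAlbanese_iota1` — GIVEN `J₁ : ComponentAlbanese … C HT` under `algebraMap L ℂ = ι₁`: the five (c)(d)
  fields BY VALUE at the rest `U.rest (restTailOne (AlgHom.id ℚ L) ι₁ hν hwν Carν (HT.rhoΩOne …))` of a conjugate-typed `ν`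
  (`hsign : Φ_ν = Φ̄(typeOfLine (line i))`), typed at the conjugate-keyed tower dictionary: `M := map43RecordAtPin J₁ …` (prove-2),
  `jH := jHPin …`, ✔ `jHPin_injective ∕ jHPin_comm`, pieces ✔ `nonempty_hcmPieces_atJRecordPin (ιg := ι₁)` with `hadmμ :=` ✔ K1
  `isReflexOfTypeG_conj_iff` ∘ `hsign` (tail presentation `ι₁` = instance `ι₁`: no Lemma-E conjugation needed).
* §2 `thm418C_ofTower_of_muConj` — adapt-1's adapter ✔ `thm418C_liuDictionaryPin_of_muConj` with the dictionary generalised from the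
  literal pin to `LiuDictionary.ofTower … adm` (any key); proof = adapt-1's over ✔ `PinSignatures.thm418C_ofTower_of_pins`.
* §3 `thm418C_ofTower_conjAdm_of_muConj_of_componentAlbanese_iota1` — wb-4's ✔ `thm418C_liuDictionaryPin_of_muConj_byValue` re-targeted:
  (c)(d) := §1 (per line, `Exists.choose`), `Ks := capThree K₀`, key := conjugate; displayed rows as wb-4's + `J₁ ∕ hΓ₁ ∕ hinst`.

Consumers: `OrientationT2MuKeyVsAlbaneseIota1.lean` (at the index of record) and `OrientationT2MuKeyVacuityOfAlbaneseIota1.lean`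
(the μ-key END's seven displayed rows + `J₁` at every face ⊢ `False`).  HC_CM is NOT proved; nothing displayed is asserted to be inhabited.

References: [Liu2021] Thm. 4.18 with (1) and proof map (4.2)∕(4.3) (FJcycle.tex l. 2232–2253), Rem. 4.4 (l. 1912–1933), Rem. 4.17, Lem. 2.4 (1),
Def. 4.5 (2), Prop. 4.6 (1), Def. 4.11, Def. 4.12, Prop. 4.13, App. D Lem. D.1 (1),(3); G. Shimura (1998) §8.3 Prop. 28.
-/

noncomputable section

open scoped TensorProduct Matrix

namespace Summit.HodgeConjecture.CorCM.D2Bridge.MuKeyHazard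

open NumberField NumberField.InfinitePlace
open HodgeCM.Model HodgeCM.Model.LiuIndex HodgeCM.Model.TowerCarrier
open HodgeCM.Literature.Theta.LiuAlbaneseModuleDatum.D2Bridge (HcmPieces)
open Summit.HodgeConjecture.CorCM.Model Summit.HodgeConjecture.CorCM.Transposition
open Literature.AlgebraicGeometry.Motives (CMType)
open Literature.AlgebraicGeometry.HodgeTheory Literature.NumberTheory.Automorphic.PicardCM
open Literature.AlgebraicGeometry.ShimuraVarieties.UnitaryCanonicalModel
open Literature.NumberTheory.ComplexMultiplication
open Literature.NumberTheory.Automorphic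
open Literature.NumberTheory.Automorphic.IdeleClassGroup (toHeckeCharacter isUnitary_toHeckeCharacter galConj
  galConj_complexConj_galConj_complexConj)
open Literature.NumberTheory.Automorphic.Liu2021 Literature.NumberTheory.Automorphic.Liu2021.AppendixC
open Literature.NumberTheory.Automorphic.Liu2021.AppendixC.RestOne
open Literature.NumberTheory.Automorphic.Liu2021.Def411WeilCarriers (lineOf locF Rep)
open Summit.HodgeConjecture.CorCM.Transposition.OmegaTransport (realUnit)
open HodgeCM.Model.ArchSideTerm (e₁)
open Literature.NumberTheory.GelbartRogawski1991 Literature.NumberTheory.GelbartRogawski1991.UnitaryDualPair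
open Literature.NumberTheory.GelbartRogawski1991.UnitaryDualPair.LocalSplitting (localMu norm_localMu continuous_localMu
  localMu_toLocalRing_eq_one_iff)
open Literature.RepresentationTheory Literature.RepresentationTheory.Liu2021
open Literature.NumberTheory.ComplexMultiplication.CMTypeOps (bar bar_bar mem_bar_iff_conjugate_mem)
open Summit.HodgeConjecture.CorCM.D2Bridge.AdapterMuConj
open Literature.NumberTheory.Transcendental (Arapura2012_Cor_15_4_6)

universe v₃

/-! ## §1 The (c)+(d) socket BY VALUE at instance `ι₁` from a HYPOTHETICAL component Albanese `J₁`, conjugate-keyed -/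

section Socket

variable {L : HodgeCM.CMField} [IsGalois ℚ (L : Type)] {ι₁ : (L : Type) →+* ℂ}

set_option synthInstance.maxHeartbeats 400000 in
set_option maxHeartbeats 3200000 in
/-- **(c)+(d) BY VALUE at instance `ι₁` for a CONJUGATE-typed character, conjugate-keyed** — GIVEN a component-Albanese record `J₁` for the
twisted App.-C datum `C` under `algebraMap L ℂ = ι₁` (a HYPOTHESIS: the tree holds this object only at `ῑ₁`), the five R3 fields over the rest
`U.rest (restTailOne (AlgHom.id ℚ L) ι₁ hν hwν Carν (HT.rhoΩOne …))` of a weight-one conjugate-symplectic `ν` with `Φ_ν = Φ̄(typeOfLine (line i))`,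
typed at the tower dictionary keyed `adm i d := d.IsReflexOfTypeG ῑ₁ (typeOfLine (line i))`: `M := map43RecordAtPin J₁ …` ([Liu2021] proof of
Thm. 4.18, map (4.2)∕(4.3)), `jH := jHPin …` (the identity into the tower), ✔ `jHPin_injective ∕ jHPin_comm`, and the pieces by ✔
`nonempty_hcmPieces_atJRecordPin (ιg := ι₁)` whose key `d.IsReflexOfTypeG ι₁ Φ_ν = d.IsReflexOfTypeG ι₁ Φ̄(T_i)` IS the conjugate key by ✔ K1
`isReflexOfTypeG_conj_iff`.  Nothing here claims `J₁` exists.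
[cite: Liu2021, proof of Thm. 4.18 map (4.2)∕(4.3) (FJcycle.tex l. 2247–2253), Thm. 4.18 (1) (l. 2239), Rem. 4.4 (l. 1930–1933), Rem. 4.17, Lem. 2.4 (1), Def. 4.5 (2), Prop. 4.6 (1)] [cite: Shimura1998, §8.3 Prop. 28] -/
theorem socket_conjAdm_of_componentAlbanese_iota1 {hHD : exists_isReal_hodgeModel} {hI : hodgePQ_independent_of_hodgeModel}
    {h₁ : BallQuotientUniformised} {h₃ : CMAbelianVarietyRealised} {hA : Arapura2012_Cor_15_4_6}
    (V : HodgeCM.HermSpace3 L ι₁) (h : exists_recordSystem) (Φ : CMType (L : Type)) {isotropicAt : ℕ → Prop}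
    {C : Sec42Data (Model.honestP5Of h ⟨L.K⟩ ι₁ ⟨V.Hm, V.isHermitian, V.signature_ι₁, V.posDef_of_ne⟩ Φ) isotropicAt}
    {HT : C.HeckeTranslates} (U : UniformOmega C)
    {ν : Literature.NumberTheory.Automorphic.IdeleClassGroup (L : Type) →ₜ* Circle} (hν : IdeleClassGroup.IsConjugateSymplectic (L : Type) ν)
    (hwν : IdeleClassGroup.HasWeight (L : Type) ν 1) (Carν : Def45.Carriers (L : Type) ν)
    (Dν : ObjOne (AlgHom.id ℚ (L : Type)) ι₁ hν hwν Carν) (τ' : (L : Type) →+* ℂ) (hτ' : τ' ∈ hν.cmType.1)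
    (I : Type) (line : I → HodgeCM.Model.SplitLineE V) (i : I)
    (hsign : hν.cmType = HodgeCM.CMTypeOps.bar (HodgeCM.Model.SplitLine.typeOfLine (line i)))
    [inst : Algebra (L : Type) ℂ] (hinst : ∀ x : (L : Type), algebraMap (L : Type) ℂ x = ι₁ x)
    (J₁ : ComponentAlbanese hHD hI (ballQuotientUniformisedDatum_of h₁) h₃ hA V h Φ C HT)
    (hΓ₁ : ∀ K₁ : C5.SmallLevel C.S.K₀, ((J₁.Γof K₁).K : Subgroup ↥V.adelicFin) = (K₁.1 : Subgroup C.G)) :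
    ∃ (M : (toThm418Data _ (U.rest (restTailOne (AlgHom.id ℚ (L : Type)) ι₁ hν hwν Carν
          (HT.rhoΩOne (AlgHom.id ℚ (L : Type)) ι₁ hν hwν Carν)))).Map43RationalData)
      (jH : M.HB →ₗ[ℂ] (LiuDictionary.ofTower hHD hI h₁ h₃ hA V I
          (fun i => {χ : (line i).CharW // (line i).IsAutChar χ}) (fun i a => (line i).Ω (HodgeCM.Model.ιVE V) a.1)
          (fun i => HodgeCM.Model.SplitLine.PhiMuLine ι₁ (line i))
          (fun i dd => dd.IsReflexOfTypeG ((starRingEnd ℂ).comp ι₁) (HodgeCM.Model.SplitLine.typeOfLine (line i)))).H),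
      Function.Injective jH ∧
      (∀ (g : ↥V.adelicFin) (x : M.HB), jH (M.ρB g x) = MonoidAlgebra.of ℂ ↥V.adelicFin g • jH x) ∧
      ∀ (K : HodgeCM.Level V), K ≤ HodgeCM.Level.capThree (V := V) (C.S.K₀.1 : Subgroup ↥V.adelicFin) C.S.K₀.2.1 →
        Nonempty (HcmPieces.{0, 1, 0}
          (toThm418Data _ (U.rest (restTailOne (AlgHom.id ℚ (L : Type)) ι₁ hν hwν Carν
            (HT.rhoΩOne (AlgHom.id ℚ (L : Type)) ι₁ hν hwν Carν))))
          M (LiuDictionary.ofTower hHD hI h₁ h₃ hA V I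
            (fun i => {χ : (line i).CharW // (line i).IsAutChar χ}) (fun i a => (line i).Ω (HodgeCM.Model.ιVE V) a.1)
            (fun i => HodgeCM.Model.SplitLine.PhiMuLine ι₁ (line i))
            (fun i dd => dd.IsReflexOfTypeG ((starRingEnd ℂ).comp ι₁) (HodgeCM.Model.SplitLine.typeOfLine (line i)))).H jH K.K
          ((HodgeCM.Model.picardCMUniverse hHD hI h₁ h₃).CohC ((HodgeCM.Model.picardCMUniverse hHD hI h₁ h₃).pms L ι₁ V K) 1)
          (resTotal hHD hI (ballQuotientUniformisedDatum_of h₁) h₃ hA K)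
          ((LiuDictionary.ofTower hHD hI h₁ h₃ hA V I
            (fun i => {χ : (line i).CharW // (line i).IsAutChar χ}) (fun i a => (line i).Ω (HodgeCM.Model.ιVE V) a.1)
            (fun i => HodgeCM.Model.SplitLine.PhiMuLine ι₁ (line i))
            (fun i dd => dd.IsReflexOfTypeG ((starRingEnd ℂ).comp ι₁) (HodgeCM.Model.SplitLine.typeOfLine (line i)))).cmClasses K i)) :=
  ⟨map43RecordAtPin J₁ (AlgHom.id ℚ (L : Type)) ι₁ hν hwν Carν U.Eps U.epsOf U.Chi (U.omega ν hν) (U.rho ν hν) Dν τ' hτ',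
    jHPin J₁ (AlgHom.id ℚ (L : Type)) ι₁ hν hwν Carν U.Eps U.epsOf U.Chi (U.omega ν hν) (U.rho ν hν) Dν τ' hτ',
    jHPin_injective _ (AlgHom.id ℚ (L : Type)) ι₁ hν hwν Carν U.Eps U.epsOf U.Chi (U.omega ν hν) (U.rho ν hν) Dν τ' hτ',
    fun g x => jHPin_comm _ (AlgHom.id ℚ (L : Type)) ι₁ hν hwν Carν U.Eps U.epsOf U.Chi (U.omega ν hν) (U.rho ν hν) Dν τ' hτ' g x,
    fun K hK => nonempty_hcmPieces_atJRecordPin I (fun i => {χ : (line i).CharW // (line i).IsAutChar χ})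
      (fun i a => (line i).Ω (HodgeCM.Model.ιVE V) a.1) (fun i => HodgeCM.Model.SplitLine.PhiMuLine ι₁ (line i))
      (fun i dd => dd.IsReflexOfTypeG ((starRingEnd ℂ).comp ι₁) (HodgeCM.Model.SplitLine.typeOfLine (line i))) hν hwν Carν
      U.Eps U.epsOf U.Chi (U.omega ν hν) (U.rho ν hν) ι₁ hinst J₁ hΓ₁ Dν τ' hτ' i K hK fun d hd => by
        rw [hsign] at hd
        exact (isReflexOfTypeG_conj_iff ι₁ d _).2 hd⟩

end Socket

/-! ## §2 The μ ↦ μᶜ adapter at the TOWER dictionary (any key) — adapt-1's theorem, dictionary generalised -/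

section Tower

set_option synthInstance.maxHeartbeats 400000 in
set_option maxHeartbeats 1600000 in
/-- **The μ ↦ μᶜ ADAPTER at the TOWER dictionary, ANY admissibility key `adm`** — the `rfl`-generalisation of adapt-1's ✔
`AdapterMuConj.thm418C_liuDictionaryPin_of_muConj` (whose dictionary `liuDictionaryPin … V I line` is this tower dictionary at
`adm i dd := dd.IsReflexOfTypeG ι₁ (typeOfLine (line i))`): ✔ `PinSignatures.thm418C_ofTower_of_pins` at the re-labelled families
`muConj (U i)` and the tails `tailC` at the conjugate characters (`hνμ : μ_i = ν_iᶜ`, [Liu2021] Rem. 4.4), the Ω-pin (b) of record at the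
`μ_i`-rests moved by adapt-1's ✔ `admIndexMuConjEquiv ∕ omegaPinMuConj ∕ omegaPinMuConj_smul`; (c) `MC ∕ jHC ∕ hjHinjC ∕ hjHC`, (d) `piecesC`
typed at `T.cmClasses K i` for `T := LiuDictionary.ofTower … adm`, and the relabelled legs — binders = adapt-1's, token for token, with the
dictionary generalised.  The proof is adapt-1's.  HC_CM is NOT proved here; «Δ2 BRIDGE CLOSED» is NOT claimed.
[cite: Liu2021, Thm. 4.18 (FJcycle.tex l. 2232–2245), Rem. 4.4 (l. 1912–1930), Def. 4.12 (l. 2102–2111), Prop. 4.13 (l. 2113–2119), Def. 4.11,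
App. D Lem. D.1 (1)–(3) (l. 5226–5233)] -/
theorem thm418C_ofTower_of_muConj {hHD : exists_isReal_hodgeModel} {hI : hodgePQ_independent_of_hodgeModel}
    {h₁ : BallQuotientUniformised} {h₃ : CMAbelianVarietyRealised} {hA : Arapura2012_Cor_15_4_6}
    {L : HodgeCM.CMField} {ι₁ : (L : Type) →+* ℂ} (V : HodgeCM.HermSpace3 L ι₁)
    (I : Type) (line : I → SplitLineE V) (adm : I → LiuCMSide → Prop)
    (h : exists_recordSystem) (Φ : Literature.AlgebraicGeometry.Motives.CMType L)
    {isotropicAt : ℕ → Prop}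
    (C : Sec42Data (Model.honestP5Of h ⟨L.K⟩ ι₁ ⟨V.Hm, V.isHermitian, V.signature_ι₁, V.posDef_of_ne⟩ Φ) isotropicAt)
    (Good : I → Prop) (hbad : ∀ i : I, SplitLine.PhiMuLine ι₁ (line i) → ¬ Good i → (HodgeCM.Model.LiuDictionary.ofTower hHD hI h₁ h₃ hA V I (fun i => {χ : (line i).CharW // (line i).IsAutChar χ}) (fun i a => (line i).Ω (ιVE V) a.1) (fun i => SplitLine.PhiMuLine ι₁ (line i)) adm).block i = ⊥)
    -- (a) the uniform carriers of the lines, the characters `μ_i` of record and their conjugates `ν_i` (`μ_i = ν_iᶜ`), the two tails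
    (U : ∀ i : I, SplitLine.PhiMuLine ι₁ (line i) → Good i → UniformOmega C)
    (μ : ∀ (i : I) (_ : SplitLine.PhiMuLine ι₁ (line i)) (_ : Good i), Literature.NumberTheory.Automorphic.IdeleClassGroup (L : Type) →ₜ* Circle)
    (hcs : ∀ (i : I) (hμ : SplitLine.PhiMuLine ι₁ (line i)) (hg : Good i), IdeleClassGroup.IsConjugateSymplectic (L : Type) (μ i hμ hg))
    (tail : ∀ (i : I) (hμ : SplitLine.PhiMuLine ι₁ (line i)) (hg : Good i), RestTail C (μ i hμ hg) (hcs i hμ hg))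
    (ν : ∀ (i : I) (_ : SplitLine.PhiMuLine ι₁ (line i)) (_ : Good i), Literature.NumberTheory.Automorphic.IdeleClassGroup (L : Type) →ₜ* Circle)
    (hcsν : ∀ (i : I) (hμ : SplitLine.PhiMuLine ι₁ (line i)) (hg : Good i), IdeleClassGroup.IsConjugateSymplectic (L : Type) (ν i hμ hg))
    (tailC : ∀ (i : I) (hμ : SplitLine.PhiMuLine ι₁ (line i)) (hg : Good i), RestTail C (ν i hμ hg) (hcsν i hμ hg))
    (hνμ : ∀ (i : I) (hμ : SplitLine.PhiMuLine ι₁ (line i)) (hg : Good i),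
      μ i hμ hg = IdeleClassGroup.galConj (IsCMField.complexConj (L : Type)) (ν i hμ hg))
    -- [Liu21, Thm 4.18] AS PRINTED for `ν_i = μ_iᶜ` at the relabelled rest (the ONE displayed instance of the adapter)
    (hLiuC : ∀ (i : I) (hμ : SplitLine.PhiMuLine ι₁ (line i)) (hg : Good i), Thm418AsPrinted (toThm418Data C ((muConj (U i hμ hg)).rest (tailC i hμ hg))))
    -- (b) the Ω-PIN OF RECORD at the `μ_i`-rest (PinSignatures (b) VERBATIM at `(U i).rest (tail i)`)
    (σ : ∀ (i : I) (hμ : SplitLine.PhiMuLine ι₁ (line i)) (hg : Good i),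
      {χ : (line i).CharW // (line i).IsAutChar χ} → (toThm418Data C ((U i hμ hg).rest (tail i hμ hg))).AdmIndex)
    (hσ : ∀ (i : I) (hμ : SplitLine.PhiMuLine ι₁ (line i)) (hg : Good i), Function.Injective (σ i hμ hg))
    (e : ∀ (i : I) (hμ : SplitLine.PhiMuLine ι₁ (line i)) (hg : Good i) (a : {χ : (line i).CharW // (line i).IsAutChar χ}),
      (line i).Ω (ιVE V) a.1 ≃ₗ[ℂ] (toThm418Data C ((U i hμ hg).rest (tail i hμ hg))).omegaAt (σ i hμ hg a))
    (he : ∀ (i : I) (hμ : SplitLine.PhiMuLine ι₁ (line i)) (hg : Good i) (a : {χ : (line i).CharW // (line i).IsAutChar χ})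
      (g : ↥V.adelicFin) (m : (line i).Ω (ιVE V) a.1),
      e i hμ hg a (MonoidAlgebra.of ℂ ↥V.adelicFin g • m) = (toThm418Data C ((U i hμ hg).rest (tail i hμ hg))).rhoAt (σ i hμ hg a) g (e i hμ hg a m))
    -- (c) SUB-LEMMA A4: the J record at the relabelled rest (PinSignatures (c) at `(muConj (U i)).rest (tailC i)`, `τ′ = ῑ₁ ∈ Φ_{ν_i}`)
    (MC : ∀ (i : I) (hμ : SplitLine.PhiMuLine ι₁ (line i)) (hg : Good i), (toThm418Data C ((muConj (U i hμ hg)).rest (tailC i hμ hg))).Map43RationalData)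
    (jHC : ∀ (i : I) (hμ : SplitLine.PhiMuLine ι₁ (line i)) (hg : Good i), (MC i hμ hg).HB →ₗ[ℂ] (HodgeCM.Model.LiuDictionary.ofTower hHD hI h₁ h₃ hA V I (fun i => {χ : (line i).CharW // (line i).IsAutChar χ}) (fun i a => (line i).Ω (ιVE V) a.1) (fun i => SplitLine.PhiMuLine ι₁ (line i)) adm).H)
    (hjHinjC : ∀ (i : I) (hμ : SplitLine.PhiMuLine ι₁ (line i)) (hg : Good i), Function.Injective (jHC i hμ hg))
    (hjHC : ∀ (i : I) (hμ : SplitLine.PhiMuLine ι₁ (line i)) (hg : Good i) (g : ↥V.adelicFin) (x : (MC i hμ hg).HB),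
      jHC i hμ hg ((MC i hμ hg).ρB g x) = MonoidAlgebra.of ℂ ↥V.adelicFin g • jHC i hμ hg x)
    -- (d) SUB-LEMMA A4: the pieces below the threshold at the relabelled rest
    (Ks : I → HodgeCM.Level V)
    (piecesC : ∀ (i : I) (hμ : SplitLine.PhiMuLine ι₁ (line i)) (hg : Good i) (K : HodgeCM.Level V), K ≤ Ks i →
      HcmPieces.{0, v₃, 0} (toThm418Data C ((muConj (U i hμ hg)).rest (tailC i hμ hg))) (MC i hμ hg) (HodgeCM.Model.LiuDictionary.ofTower hHD hI h₁ h₃ hA V I (fun i => {χ : (line i).CharW // (line i).IsAutChar χ}) (fun i a => (line i).Ω (ιVE V) a.1) (fun i => SplitLine.PhiMuLine ι₁ (line i)) adm).H (jHC i hμ hg) K.K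
        ((HodgeCM.Model.picardCMUniverse hHD hI h₁ h₃).CohC ((HodgeCM.Model.picardCMUniverse hHD hI h₁ h₃).pms L ι₁ V K) 1)
        (resTotal hHD hI (ballQuotientUniformisedDatum_of h₁) h₃ hA K) ((HodgeCM.Model.LiuDictionary.ofTower hHD hI h₁ h₃ hA V I (fun i => {χ : (line i).CharW // (line i).IsAutChar χ}) (fun i a => (line i).Ω (ιVE V) a.1) (fun i => SplitLine.PhiMuLine ι₁ (line i)) adm).cmClasses K i))
    -- SUB-LEMMA A3: the [Lem D.1 (1)] ∕ [Prop 4.13] ∕ [Def 4.11] ∕ [Lem D.1 (3)] legs at the relabelled family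
    (hnvDC : ∀ (i : I) (hμ : SplitLine.PhiMuLine ι₁ (line i)) (hg : Good i) (j : (toThm418Data C ((muConj (U i hμ hg)).rest (tailC i hμ hg))).AdmIndex),
      Nontrivial ((toThm418Data C ((muConj (U i hμ hg)).rest (tailC i hμ hg))).omegaAt j))
    (h413C : ∀ (i : I) (hμ : SplitLine.PhiMuLine ι₁ (line i)) (hg : Good i), Prop413AsPrinted ((muConj (U i hμ hg)).prop413Data (HodgeCM.Model.LiuDictionary.ofTower hHD hI h₁ h₃ hA V I (fun i => {χ : (line i).CharW // (line i).IsAutChar χ}) (fun i a => (line i).Ω (ιVE V) a.1) (fun i => SplitLine.PhiMuLine ι₁ (line i)) adm).H))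
    (h411C : ∀ (i : I) (hμ : SplitLine.PhiMuLine ι₁ (line i)) (hg : Good i) (t : ((muConj (U i hμ hg)).prop413Data (HodgeCM.Model.LiuDictionary.ofTower hHD hI h₁ h₃ hA V I (fun i => {χ : (line i).CharW // (line i).IsAutChar χ}) (fun i a => (line i).Ω (ιVE V) a.1) (fun i => SplitLine.PhiMuLine ι₁ (line i)) adm).H).AdmTriple), IsIrreducibleOrZero (((muConj (U i hμ hg)).prop413Data (HodgeCM.Model.LiuDictionary.ofTower hHD hI h₁ h₃ hA V I (fun i => {χ : (line i).CharW // (line i).IsAutChar χ}) (fun i a => (line i).Ω (ιVE V) a.1) (fun i => SplitLine.PhiMuLine ι₁ (line i)) adm).H).rhoAt t) ∧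
      IsSmoothRep (((muConj (U i hμ hg)).prop413Data (HodgeCM.Model.LiuDictionary.ofTower hHD hI h₁ h₃ hA V I (fun i => {χ : (line i).CharW // (line i).IsAutChar χ}) (fun i a => (line i).Ω (ιVE V) a.1) (fun i => SplitLine.PhiMuLine ι₁ (line i)) adm).H).rhoAt t) ∧ IsAdmissibleRep (((muConj (U i hμ hg)).prop413Data (HodgeCM.Model.LiuDictionary.ofTower hHD hI h₁ h₃ hA V I (fun i => {χ : (line i).CharW // (line i).IsAutChar χ}) (fun i a => (line i).Ω (ιVE V) a.1) (fun i => SplitLine.PhiMuLine ι₁ (line i)) adm).H).rhoAt t))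
    (hsepC : ∀ (i : I) (hμ : SplitLine.PhiMuLine ι₁ (line i)) (hg : Good i) (s t : ((muConj (U i hμ hg)).prop413Data (HodgeCM.Model.LiuDictionary.ofTower hHD hI h₁ h₃ hA V I (fun i => {χ : (line i).CharW // (line i).IsAutChar χ}) (fun i a => (line i).Ω (ιVE V) a.1) (fun i => SplitLine.PhiMuLine ι₁ (line i)) adm).H).AdmTriple), Nontrivial (((muConj (U i hμ hg)).prop413Data (HodgeCM.Model.LiuDictionary.ofTower hHD hI h₁ h₃ hA V I (fun i => {χ : (line i).CharW // (line i).IsAutChar χ}) (fun i a => (line i).Ω (ιVE V) a.1) (fun i => SplitLine.PhiMuLine ι₁ (line i)) adm).H).omegaAt s) →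
      (∃ f : ((muConj (U i hμ hg)).prop413Data (HodgeCM.Model.LiuDictionary.ofTower hHD hI h₁ h₃ hA V I (fun i => {χ : (line i).CharW // (line i).IsAutChar χ}) (fun i a => (line i).Ω (ιVE V) a.1) (fun i => SplitLine.PhiMuLine ι₁ (line i)) adm).H).omegaAt s ≃ₗ[ℂ] ((muConj (U i hμ hg)).prop413Data (HodgeCM.Model.LiuDictionary.ofTower hHD hI h₁ h₃ hA V I (fun i => {χ : (line i).CharW // (line i).IsAutChar χ}) (fun i a => (line i).Ω (ιVE V) a.1) (fun i => SplitLine.PhiMuLine ι₁ (line i)) adm).H).omegaAt t,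
        ∀ (g : ↥V.adelicFin) (v : ((muConj (U i hμ hg)).prop413Data (HodgeCM.Model.LiuDictionary.ofTower hHD hI h₁ h₃ hA V I (fun i => {χ : (line i).CharW // (line i).IsAutChar χ}) (fun i a => (line i).Ω (ιVE V) a.1) (fun i => SplitLine.PhiMuLine ι₁ (line i)) adm).H).omegaAt s),
          f (((muConj (U i hμ hg)).prop413Data (HodgeCM.Model.LiuDictionary.ofTower hHD hI h₁ h₃ hA V I (fun i => {χ : (line i).CharW // (line i).IsAutChar χ}) (fun i a => (line i).Ω (ιVE V) a.1) (fun i => SplitLine.PhiMuLine ι₁ (line i)) adm).H).rhoAt s g v) = ((muConj (U i hμ hg)).prop413Data (HodgeCM.Model.LiuDictionary.ofTower hHD hI h₁ h₃ hA V I (fun i => {χ : (line i).CharW // (line i).IsAutChar χ}) (fun i a => (line i).Ω (ιVE V) a.1) (fun i => SplitLine.PhiMuLine ι₁ (line i)) adm).H).rhoAt t g (f v)) → s = t)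
    (hK : ∃ K : Subgroup ↥V.adelicFin, IsOpenCompact K) :
    (HodgeCM.Model.LiuDictionary.ofTower hHD hI h₁ h₃ hA V I (fun i => {χ : (line i).CharW // (line i).IsAutChar χ}) (fun i a => (line i).Ω (ιVE V) a.1) (fun i => SplitLine.PhiMuLine ι₁ (line i)) adm).Thm418C :=
  PinSignatures.thm418C_ofTower_of_pins V (ιVE V) I (fun i => {χ : (line i).CharW // (line i).IsAutChar χ}) line (fun _ a => a.1)
    (fun i => SplitLine.PhiMuLine ι₁ (line i)) adm h Φ C Good hbad (fun i hμ hg => muConj (U i hμ hg))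
    (fun i hμ hg => (muConj (U i hμ hg)).rest (tailC i hμ hg)) tailC hLiuC
    (fun i hμ hg a => admIndexMuConjEquiv (U i hμ hg) (tail i hμ hg) (tailC i hμ hg) (hνμ i hμ hg) (σ i hμ hg a))
    (fun i hμ hg => (Equiv.injective _).comp (hσ i hμ hg))
    (fun i hμ hg a => omegaPinMuConj (U i hμ hg) (tail i hμ hg) (tailC i hμ hg) (hνμ i hμ hg) (σ i hμ hg a) (e i hμ hg a))
    (fun i hμ hg a g m => omegaPinMuConj_smul (U i hμ hg) (tail i hμ hg) (tailC i hμ hg) (hνμ i hμ hg) (σ i hμ hg a) (e i hμ hg a)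
      (he i hμ hg a) g m)
    MC jHC hjHinjC hjHC Ks piecesC hnvDC h413C h411C hsepC hK

/-! ## §3 Rows + `J₁` at instance `ι₁` ⟹ the conjugate-keyed `Thm418C` (generic tower form) -/

set_option synthInstance.maxHeartbeats 400000 in
set_option maxHeartbeats 3200000 in
/-- **THE ADAPTER'S ROWS + A COMPONENT ALBANESE AT INSTANCE `ι₁` ⟹ THE CONJUGATE-KEYED `Thm418C` (generic tower form)** — the twin of
wb-4's ✔ `AdapterMuConjByValue.thm418C_liuDictionaryPin_of_muConj_byValue` in which (c)(d) are supplied BY VALUE not from the tree's cofan at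
`ῑ₁` (✔ `componentAlbanesePinTotal`) into the LIVE key, but from a HYPOTHETICAL component-Albanese record `J₁` at instance `ι₁` (§1) into the
CONJUGATE key `adm i d := d.IsReflexOfTypeG ῑ₁ (typeOfLine (line i))` — for conjugate-typed served characters `ν_i` (`hsign`), on the
`ι₁`-presented one-object tails `restTailOne (AlgHom.id ℚ L) ι₁ (hcsν i) (hwν i) (Carν i) (HT.rhoΩOne …)`.  Displayed: `hbad`; the carriers `U i`,
characters `μ i` with tails `tail i` and the Ω-pin of record `σ ∕ hσ ∕ e ∕ he`; the conjugate characters `ν i` (`hνμ`), `hwν`, `Carν`, ONE object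
`Dν i` of 𝒜(ν_i) ([Liu2021] Prop. 4.6 (1)), `τ' i ∈ Φ_{ν_i}`, `hsign`; `hLiuC` = [Thm. 4.18] AS PRINTED at the re-labelled rests (a READING r8);
the relabelled legs `hnvDC ∕ h413C ∕ h411C ∕ hsepC`; `hK`; and the HYPOTHESIS `J₁ ∕ hΓ₁` under `algebraMap L ℂ = ι₁`.  Nothing here claims `J₁`
exists.  HC_CM is NOT proved; «Δ2 BRIDGE CLOSED» is NOT claimed.
[cite: Liu2021, Thm. 4.18 (FJcycle.tex l. 2232–2245) with (1) and proof map (4.2)∕(4.3) (l. 2247–2253), Rem. 4.4, Prop. 4.6 (1), Def. 4.5 (2),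
Def. 4.11, Def. 4.12, Prop. 4.13, App. D Lem. D.1 (1)–(3)] [cite: Shimura1998, §8.3 Prop. 28] -/
theorem thm418C_ofTower_conjAdm_of_muConj_of_componentAlbanese_iota1 {hHD : exists_isReal_hodgeModel} {hI : hodgePQ_independent_of_hodgeModel}
    {h₁ : BallQuotientUniformised} {h₃ : CMAbelianVarietyRealised} {hA : Arapura2012_Cor_15_4_6}
    {L : HodgeCM.CMField} [IsGalois ℚ (L : Type)] {ι₁ : (L : Type) →+* ℂ} (V : HodgeCM.HermSpace3 L ι₁)
    (h : exists_recordSystem) (Φ : Literature.AlgebraicGeometry.Motives.CMType L) (I : Type) (line : I → SplitLineE V)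
    {isotropicAt : ℕ → Prop}
    (C : Sec42Data (Model.honestP5Of h ⟨L.K⟩ ι₁ ⟨V.Hm, V.isHermitian, V.signature_ι₁, V.posDef_of_ne⟩ Φ) isotropicAt)
    (HT : C.HeckeTranslates)
    (Good : I → Prop) (hbad : ∀ i : I, SplitLine.PhiMuLine ι₁ (line i) → ¬ Good i → (HodgeCM.Model.LiuDictionary.ofTower hHD hI h₁ h₃ hA V I (fun i => {χ : (line i).CharW // (line i).IsAutChar χ}) (fun i a => (line i).Ω (ιVE V) a.1) (fun i => SplitLine.PhiMuLine ι₁ (line i)) (fun i dd => dd.IsReflexOfTypeG ((starRingEnd ℂ).comp ι₁) (SplitLine.typeOfLine (line i)))).block i = ⊥)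
    -- (a) the uniform carriers of the lines, the characters `μ_i` of record and their conjugates `ν_i` (`μ_i = ν_iᶜ`), the two tails
    (U : ∀ i : I, SplitLine.PhiMuLine ι₁ (line i) → Good i → UniformOmega C)
    (μ : ∀ (i : I) (_ : SplitLine.PhiMuLine ι₁ (line i)) (_ : Good i), Literature.NumberTheory.Automorphic.IdeleClassGroup (L : Type) →ₜ* Circle)
    (hcs : ∀ (i : I) (hμ : SplitLine.PhiMuLine ι₁ (line i)) (hg : Good i), IdeleClassGroup.IsConjugateSymplectic (L : Type) (μ i hμ hg))
    (tail : ∀ (i : I) (hμ : SplitLine.PhiMuLine ι₁ (line i)) (hg : Good i), RestTail C (μ i hμ hg) (hcs i hμ hg))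
    (ν : ∀ (i : I) (_ : SplitLine.PhiMuLine ι₁ (line i)) (_ : Good i), Literature.NumberTheory.Automorphic.IdeleClassGroup (L : Type) →ₜ* Circle)
    (hcsν : ∀ (i : I) (hμ : SplitLine.PhiMuLine ι₁ (line i)) (hg : Good i), IdeleClassGroup.IsConjugateSymplectic (L : Type) (ν i hμ hg))
    (hwν : ∀ (i : I) (hμ : SplitLine.PhiMuLine ι₁ (line i)) (hg : Good i), IdeleClassGroup.HasWeight (L : Type) (ν i hμ hg) 1)
    (Carν : ∀ (i : I) (hμ : SplitLine.PhiMuLine ι₁ (line i)) (hg : Good i), Def45.Carriers (L : Type) (ν i hμ hg))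
    (Dν : ∀ (i : I) (hμ : SplitLine.PhiMuLine ι₁ (line i)) (hg : Good i),
      ObjOne (AlgHom.id ℚ (L : Type)) ι₁ (hcsν i hμ hg) (hwν i hμ hg) (Carν i hμ hg))
    (τ' : ∀ (i : I) (_ : SplitLine.PhiMuLine ι₁ (line i)) (_ : Good i), (L : Type) →+* ℂ)
    (hτ' : ∀ (i : I) (hμ : SplitLine.PhiMuLine ι₁ (line i)) (hg : Good i), τ' i hμ hg ∈ (hcsν i hμ hg).cmType.1)
    (hsign : ∀ (i : I) (hμ : SplitLine.PhiMuLine ι₁ (line i)) (hg : Good i),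
      (hcsν i hμ hg).cmType = HodgeCM.CMTypeOps.bar (SplitLine.typeOfLine (line i)))
    (hνμ : ∀ (i : I) (hμ : SplitLine.PhiMuLine ι₁ (line i)) (hg : Good i),
      μ i hμ hg = IdeleClassGroup.galConj (IsCMField.complexConj (L : Type)) (ν i hμ hg))
    -- [Liu21, Thm 4.18] AS PRINTED for `ν_i = μ_iᶜ` at the relabelled rest (the ONE displayed instance of the adapter)
    (hLiuC : ∀ (i : I) (hμ : SplitLine.PhiMuLine ι₁ (line i)) (hg : Good i), Thm418AsPrinted (toThm418Data C ((muConj (U i hμ hg)).rest (restTailOne (AlgHom.id ℚ (L : Type)) ι₁ (hcsν i hμ hg) (hwν i hμ hg) (Carν i hμ hg) (HT.rhoΩOne (AlgHom.id ℚ (L : Type)) ι₁ (hcsν i hμ hg) (hwν i hμ hg) (Carν i hμ hg))))))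
    -- (b) the Ω-PIN OF RECORD at the `μ_i`-rest (PinSignatures (b) VERBATIM at `(U i).rest (tail i)`)
    (σ : ∀ (i : I) (hμ : SplitLine.PhiMuLine ι₁ (line i)) (hg : Good i),
      {χ : (line i).CharW // (line i).IsAutChar χ} → (toThm418Data C ((U i hμ hg).rest (tail i hμ hg))).AdmIndex)
    (hσ : ∀ (i : I) (hμ : SplitLine.PhiMuLine ι₁ (line i)) (hg : Good i), Function.Injective (σ i hμ hg))
    (e : ∀ (i : I) (hμ : SplitLine.PhiMuLine ι₁ (line i)) (hg : Good i) (a : {χ : (line i).CharW // (line i).IsAutChar χ}),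
      (line i).Ω (ιVE V) a.1 ≃ₗ[ℂ] (toThm418Data C ((U i hμ hg).rest (tail i hμ hg))).omegaAt (σ i hμ hg a))
    (he : ∀ (i : I) (hμ : SplitLine.PhiMuLine ι₁ (line i)) (hg : Good i) (a : {χ : (line i).CharW // (line i).IsAutChar χ})
      (g : ↥V.adelicFin) (m : (line i).Ω (ιVE V) a.1),
      e i hμ hg a (MonoidAlgebra.of ℂ ↥V.adelicFin g • m) = (toThm418Data C ((U i hμ hg).rest (tail i hμ hg))).rhoAt (σ i hμ hg a) g (e i hμ hg a m))
    -- SUB-LEMMA A3: the [Lem D.1 (1)] ∕ [Prop 4.13] ∕ [Def 4.11] ∕ [Lem D.1 (3)] legs at the relabelled family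
    (hnvDC : ∀ (i : I) (hμ : SplitLine.PhiMuLine ι₁ (line i)) (hg : Good i) (j : (toThm418Data C ((muConj (U i hμ hg)).rest (restTailOne (AlgHom.id ℚ (L : Type)) ι₁ (hcsν i hμ hg) (hwν i hμ hg) (Carν i hμ hg) (HT.rhoΩOne (AlgHom.id ℚ (L : Type)) ι₁ (hcsν i hμ hg) (hwν i hμ hg) (Carν i hμ hg))))).AdmIndex),
      Nontrivial ((toThm418Data C ((muConj (U i hμ hg)).rest (restTailOne (AlgHom.id ℚ (L : Type)) ι₁ (hcsν i hμ hg) (hwν i hμ hg) (Carν i hμ hg) (HT.rhoΩOne (AlgHom.id ℚ (L : Type)) ι₁ (hcsν i hμ hg) (hwν i hμ hg) (Carν i hμ hg))))).omegaAt j))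
    (h413C : ∀ (i : I) (hμ : SplitLine.PhiMuLine ι₁ (line i)) (hg : Good i), Prop413AsPrinted ((muConj (U i hμ hg)).prop413Data (HodgeCM.Model.LiuDictionary.ofTower hHD hI h₁ h₃ hA V I (fun i => {χ : (line i).CharW // (line i).IsAutChar χ}) (fun i a => (line i).Ω (ιVE V) a.1) (fun i => SplitLine.PhiMuLine ι₁ (line i)) (fun i dd => dd.IsReflexOfTypeG ((starRingEnd ℂ).comp ι₁) (SplitLine.typeOfLine (line i)))).H))
    (h411C : ∀ (i : I) (hμ : SplitLine.PhiMuLine ι₁ (line i)) (hg : Good i) (t : ((muConj (U i hμ hg)).prop413Data (HodgeCM.Model.LiuDictionary.ofTower hHD hI h₁ h₃ hA V I (fun i => {χ : (line i).CharW // (line i).IsAutChar χ}) (fun i a => (line i).Ω (ιVE V) a.1) (fun i => SplitLine.PhiMuLine ι₁ (line i)) (fun i dd => dd.IsReflexOfTypeG ((starRingEnd ℂ).comp ι₁) (SplitLine.typeOfLine (line i)))).H).AdmTriple), IsIrreducibleOrZero (((muConj (U i hμ hg)).prop413Data (HodgeCM.Model.LiuDictionary.ofTower hHD hI h₁ h₃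 hA V I (fun i => {χ : (line i).CharW // (line i).IsAutChar χ}) (fun i a => (line i).Ω (ιVE V) a.1) (fun i => SplitLine.PhiMuLine ι₁ (line i)) (fun i dd => dd.IsReflexOfTypeG ((starRingEnd ℂ).comp ι₁) (SplitLine.typeOfLine (line i)))).H).rhoAt t) ∧
      IsSmoothRep (((muConj (U i hμ hg)).prop413Data (HodgeCM.Model.LiuDictionary.ofTower hHD hI h₁ h₃ hA V I (fun i => {χ : (line i).CharW // (line i).IsAutChar χ}) (fun i a => (line i).Ω (ιVE V) a.1) (fun i => SplitLine.PhiMuLine ι₁ (line i)) (fun i dd => dd.IsReflexOfTypeG ((starRingEnd ℂ).comp ι₁) (SplitLine.typeOfLine (line i)))).H).rhoAt t) ∧ IsAdmissibleRep (((muConj (U i hμ hg)).prop413Data (HodgeCM.Model.LiuDictionary.ofTower hHD hI h₁ h₃ hA V I (fun i => {χ : (line i).CharW // (line i).IsAutChar χ}) (fun i a => (line i).Ω (ιVE V) a.1) (fun i => SplitLine.PhiMuLine ι₁ (line i)) (fun i dd => dd.IsReflexOfTypeG ((starRingEnd ℂ).comp ι₁) (SplitLine.typeOfLine (line i)))).H).rhoAt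 t))
    (hsepC : ∀ (i : I) (hμ : SplitLine.PhiMuLine ι₁ (line i)) (hg : Good i) (s t : ((muConj (U i hμ hg)).prop413Data (HodgeCM.Model.LiuDictionary.ofTower hHD hI h₁ h₃ hA V I (fun i => {χ : (line i).CharW // (line i).IsAutChar χ}) (fun i a => (line i).Ω (ιVE V) a.1) (fun i => SplitLine.PhiMuLine ι₁ (line i)) (fun i dd => dd.IsReflexOfTypeG ((starRingEnd ℂ).comp ι₁) (SplitLine.typeOfLine (line i)))).H).AdmTriple), Nontrivial (((muConj (U i hμ hg)).prop413Data (HodgeCM.Model.LiuDictionary.ofTower hHD hI h₁ h₃ hA V I (fun i => {χ : (line i).CharW // (line i).IsAutChar χ}) (fun i a => (line i).Ω (ιVE V) a.1) (fun i => SplitLine.PhiMuLine ι₁ (line i)) (fun i dd => dd.IsReflexOfTypeG ((starRingEnd ℂ).comp ι₁) (SplitLine.typeOfLine (line i)))).H).omegaAt s) →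
      (∃ f : ((muConj (U i hμ hg)).prop413Data (HodgeCM.Model.LiuDictionary.ofTower hHD hI h₁ h₃ hA V I (fun i => {χ : (line i).CharW // (line i).IsAutChar χ}) (fun i a => (line i).Ω (ιVE V) a.1) (fun i => SplitLine.PhiMuLine ι₁ (line i)) (fun i dd => dd.IsReflexOfTypeG ((starRingEnd ℂ).comp ι₁) (SplitLine.typeOfLine (line i)))).H).omegaAt s ≃ₗ[ℂ] ((muConj (U i hμ hg)).prop413Data (HodgeCM.Model.LiuDictionary.ofTower hHD hI h₁ h₃ hA V I (fun i => {χ : (line i).CharW // (line i).IsAutChar χ}) (fun i a => (line i).Ω (ιVE V) a.1) (fun i => SplitLine.PhiMuLine ι₁ (line i)) (fun i dd => dd.IsReflexOfTypeG ((starRingEnd ℂ).comp ι₁) (SplitLine.typeOfLine (line i)))).H).omegaAt t,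
        ∀ (g : ↥V.adelicFin) (v : ((muConj (U i hμ hg)).prop413Data (HodgeCM.Model.LiuDictionary.ofTower hHD hI h₁ h₃ hA V I (fun i => {χ : (line i).CharW // (line i).IsAutChar χ}) (fun i a => (line i).Ω (ιVE V) a.1) (fun i => SplitLine.PhiMuLine ι₁ (line i)) (fun i dd => dd.IsReflexOfTypeG ((starRingEnd ℂ).comp ι₁) (SplitLine.typeOfLine (line i)))).H).omegaAt s),
          f (((muConj (U i hμ hg)).prop413Data (HodgeCM.Model.LiuDictionary.ofTower hHD hI h₁ h₃ hA V I (fun i => {χ : (line i).CharW // (line i).IsAutChar χ}) (fun i a => (line i).Ω (ιVE V) a.1) (fun i => SplitLine.PhiMuLine ι₁ (line i)) (fun i dd => dd.IsReflexOfTypeG ((starRingEnd ℂ).comp ι₁) (SplitLine.typeOfLine (line i)))).H).rhoAt s g v) = ((muConj (U i hμ hg)).prop413Data (HodgeCM.Model.LiuDictionary.ofTower hHD hI h₁ h₃ hA V I (fun i => {χ : (line i).CharW // (line i).IsAutChar χ}) (fun i a => (line i).Ω (ιVE V) a.1) (fun i => SplitLine.PhiMuLine ι₁ (line i)) (fun i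 dd => dd.IsReflexOfTypeG ((starRingEnd ℂ).comp ι₁) (SplitLine.typeOfLine (line i)))).H).rhoAt t g (f v)) → s = t)
    (hK : ∃ K : Subgroup ↥V.adelicFin, IsOpenCompact K)
    -- THE HYPOTHESIS: a component-Albanese record for `C` at instance `ι₁` (NOT in the tree), with its level law
    [inst : Algebra (L : Type) ℂ] (hinst : ∀ x : (L : Type), algebraMap (L : Type) ℂ x = ι₁ x)
    (J₁ : ComponentAlbanese hHD hI (ballQuotientUniformisedDatum_of h₁) h₃ hA V h Φ C HT)
    (hΓ₁ : ∀ K₁ : C5.SmallLevel C.S.K₀, ((J₁.Γof K₁).K : Subgroup ↥V.adelicFin) = (K₁.1 : Subgroup C.G)) :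
    (HodgeCM.Model.LiuDictionary.ofTower hHD hI h₁ h₃ hA V I (fun i => {χ : (line i).CharW // (line i).IsAutChar χ}) (fun i a => (line i).Ω (ιVE V) a.1) (fun i => SplitLine.PhiMuLine ι₁ (line i)) (fun i dd => dd.IsReflexOfTypeG ((starRingEnd ℂ).comp ι₁) (SplitLine.typeOfLine (line i)))).Thm418C := by
  have S := fun (i : I) (hμ : SplitLine.PhiMuLine ι₁ (line i)) (hg : Good i) =>
    socket_conjAdm_of_componentAlbanese_iota1 (hHD := hHD) (hI := hI) (h₁ := h₁) (h₃ := h₃) (hA := hA) V h Φ (C := C) (HT := HT)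
      (muConj (U i hμ hg)) (hcsν i hμ hg) (hwν i hμ hg) (Carν i hμ hg) (Dν i hμ hg) (τ' i hμ hg) (hτ' i hμ hg) I line i (hsign i hμ hg)
      hinst J₁ hΓ₁
  exact thm418C_ofTower_of_muConj V I line (fun i dd => dd.IsReflexOfTypeG ((starRingEnd ℂ).comp ι₁) (SplitLine.typeOfLine (line i))) h Φ C Good hbad U μ hcs tail ν hcsν
    (fun i hμ hg => (restTailOne (AlgHom.id ℚ (L : Type)) ι₁ (hcsν i hμ hg) (hwν i hμ hg) (Carν i hμ hg) (HT.rhoΩOne (AlgHom.id ℚ (L : Type)) ι₁ (hcsν i hμ hg) (hwν i hμ hg) (Carν i hμ hg))))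
    hνμ hLiuC σ hσ e he
    (fun i hμ hg => (S i hμ hg).choose) (fun i hμ hg => (S i hμ hg).choose_spec.choose)
    (fun i hμ hg => (S i hμ hg).choose_spec.choose_spec.1) (fun i hμ hg => (S i hμ hg).choose_spec.choose_spec.2.1)
    (fun _ => HodgeCM.Level.capThree (V := V) (C.S.K₀.1 : Subgroup ↥V.adelicFin) C.S.K₀.2.1)
    (fun i hμ hg K hK => Classical.choice ((S i hμ hg).choose_spec.choose_spec.2.2 K hK))
    hnvDC h413C h411C hsepC hK

end Tower

end Summit.HodgeConjecture.CorCM.D2Bridge.MuKeyHazard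

end
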